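import Summits.QuantumFields.YangMills.Theorems.BalabanUVNodesN16SchemeSandwich
import HarnessLib

/-!
# YM-DAG node N16 (NE3), the located averaging pin (42) ↔ (0.4) — part 37: N16's ACTION-RATE END FOR AN ARBITRARY AVERAGING SCHEME `s` FROM SANDWICH DATA — pub-balaban's
# `actionRate_of_sandwichData` with (43) replaced by `s` and EXACTLY ONE new displayed letter: the geometric bound on the ONE-STEP ACTION DISCREPANCY of the competitors

Cell `pub-ymgap`, width seat `pub-ymgap-dag-n16-w3` (director-ym №197 ∕ HUMAN RULING D-0149), generation 9; part 37 of the W1b lineage (part 34 `…N16SchemeSandwich`: the generic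
sandwich with the wall plugged and `D` displayed; pub-balaban `MinimalActionRate`: `SandwichData`, `Regular`, `rate_algebra`, `actionRate_of_sandwichData`).
`--supports stmt-QuantumFields-27366 --as helper` (K3⁸, KEY MAP v2; count-neutral; definition lane: one Prop-valued structure).  `bears_on: R4∕N16`.

WHAT IS PROVED.
 * §1 `SandwichDataS d s 𝒞 L N b g Dk V` — pub-balaban's `SandwichData` (B11 Thm 1 TYPE inputs: minimisers of every run, their regularity, class membership of the averaged finer
   minimiser, regular refinements of the coarser minimiser) with the (43)-constraint replaced by the `s`-constraint (g0's `IsMinimiserS`, `s (k+1) ·` in place of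
   `rescale L ∘ bavg L`) PLUS ONE FIELD per competitor: its ONE-STEP ACTION DISCREPANCY `|A^{(k)}(step42 U) − A^{(k)}(s (k+1) U)| ≤ Dk k`.  A hypothesis SHAPE (asserted for no
   scheme; for `s = step42` the discrepancy field holds with `Dk = 0` and the structure IS `SandwichData`, `sandwichDataS_step42_of`).
 * §2 ★★ `abs_sInf_sub_le_rate_add` — the per-level rate bound: `|A^s_k(V) − A^s_{k+1}(V)| ≤ [wall(d,L)(g+b³)∕L²]·(L^{−2})^k·N^d + Dk k` (pub-balaban's `abs_minAct_sub_le_rate`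
   proof VERBATIM on part 34's `abs_sInf_succ_sub_sInf_le_wall_add`).
 * §3 ★★★ `actionRate_schemeReadings_of_sandwichDataS` — N16's END (A) `T4EtaRateMin.ActionRate` for the `s`-constrained minimal actions (the displayed carrier
   `⟨dom, inf A^{(k)}(admissibleS s 𝒞 k ·), loc, N^d⟩`) with constant `wall(d,L)(g+b³)∕L² + C_D` and rate `L^{−2}`, from `SandwichDataS` on `dom` and `Dk k ≤ C_D (L^{−2})^k N^d`.
   For `s := step04 F N` on N16's `SU(N)`-valued small-field classes this is THE (0.4)-SIDE END (A) with exactly the located inputs displayed: B11 Thm 1 TYPE for the (0.4)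
   constraint ([Balaban1987RG1] p. 254's claim — g0's `H7Body (step04)` display) and the per-step action discrepancy `Dk = O(ε³ L^{−2k})·N^4` (parts 35∕36: third order per
   plaquette from equal determinants — DISCHARGED, part 36 — and second-order close logarithms (S) — displayed).
READING (honest; for the planners, D-0014).  This closes the g9 constructive road as one consumer-ready theorem parallel to pub-balaban's (43) theorem; the pin's remaining analytic
inputs are (S) (parts 22∕25∕26 in BCH currency) and the (0.4)-side Theorem-1 data; no minimiser is constructed; nothing is claimed about their existence.

HONEST FRAMING.  [folklore] bookkeeping BY NAME (pub-balaban's rate algebra re-run); one Prop-valued hypothesis SHAPE asserted for nothing; 0 `sorry`, no `instance`, no `notation`;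
NO estimate; nothing of [Balaban1985Variational] ∕ [Balaban1987RG1] asserted; K3⁸ stubs `stub_rates13HV` ∕ `stub_expansion13HV` NOT touched; N16 ∕ NE3 NOT discharged; count-neutral
(typed 28∕28 · discharged 5∕27 work-bound, A 5∕28 — unmoved).  One finite four-torus programme at fixed `ε` — the Yang–Mills mass gap (Clay) is NOT proved by any of this; R4 closes
the conditional finite-𝕋⁴ rung `BalabanLadder.UV` only; nothing continuum ∕ ℝ⁴ ∕ OS.
-/

set_option autoImplicit false

open scoped BigOperators Matrix Matrix.Norms.L2Operator
open NormedSpace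

namespace Summit.QuantumFields.YangMills.BalabanUVNodes.N16SchemeSandwichRate

open Literature.MathematicalPhysics.QuantumFieldTheory.Balaban1983to89
open B7Prop1Explicit B7Prop2Explicit
open T4AveragingDeficitWall (IsUnitaryCfg SmallField gradFluxSq)
open T4AveragingDeficitWallBoundary (IsPeriodicCfg periodBox)
open T4AveragingDeficitNonAbelian (wallConstNA wallConstNA_nonneg)
open T4EtaRateMin (ActionRate)
open Summit.QuantumFields.BalabanUV.T4Continuum
open MinimalActionLevels (levelAction stepWt stepWt_pos)
open MinimalActionSandwich (IsMinimiser)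
open MinimalActionRate (Regular SandwichData rate_algebra stepWt_inv_eq)
open Summit.QuantumFields.YangMills.BalabanUVNodes.N16AveragingPin (avgIterS step42 admissibleS IsMinimiserS isMinimiserS_step42_iff)
open Summit.QuantumFields.YangMills.BalabanUVNodes.N16SchemeSandwich (abs_sInf_succ_sub_sInf_le_wall_add)

noncomputable section

variable {d : ℕ} {n : Type*} [Fintype n] [DecidableEq n]

/-! ## §1 Sandwich data for the `s`-constrained problem, with the one-step action discrepancy of the competitors -/

variable (d) in
/-- **SANDWICH DATA FOR THE SCHEME `s` AT A DATUM `V`** — pub-balaban's `SandwichData` with `IsMinimiser ↦ IsMinimiserS s`, `rescale L (bavg L U) ↦ s (k+1) U`, and for each of the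
two competitors of run `k+1` (the minimiser, the refinement) the bound `Dk k` on its ONE-STEP ACTION DISCREPANCY `|A^{(k)}(step42 U) − A^{(k)}(s (k+1) U)|`.  B11 Thm 1 TYPE inputs +
the new letter; a hypothesis SHAPE, asserted for no scheme or datum. [folklore] -/
@[folklore]
structure SandwichDataS (s : ℕ → (Site d → Fin d → (Matrix n n ℂ)ˣ) → (Site d → Fin d → (Matrix n n ℂ)ˣ)) (𝒞 : ℕ → Set (Site d → Fin d → (Matrix n n ℂ)ˣ))
    (L N : ℕ) (b g : ℝ) (Dk : ℕ → ℝ) (V : Site d → Fin d → (Matrix n n ℂ)ˣ) : Prop where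
  /-- (H1) existence of an `s`-constrained minimiser of every run -/
  exists_minimiser : ∀ k : ℕ, ∃ U, IsMinimiserS d s 𝒞 L N k V U
  /-- (H3) regularity of the minimisers -/
  regular : ∀ (k : ℕ) (U : Site d → Fin d → (Matrix n n ℂ)ˣ), IsMinimiserS d s 𝒞 L N (k + 1) V U → Regular d L N b g (k + 1) U
  /-- (H4) the `s`-averaged finer minimiser lies in the coarser class -/
  avg_mem : ∀ (k : ℕ) (U : Site d → Fin d → (Matrix n n ℂ)ˣ), IsMinimiserS d s 𝒞 L N (k + 1) V U → s (k + 1) U ∈ 𝒞 k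
  /-- (D) the minimiser's one-step action discrepancy -/
  discr : ∀ (k : ℕ) (U : Site d → Fin d → (Matrix n n ℂ)ˣ), IsMinimiserS d s 𝒞 L N (k + 1) V U →
    |levelAction d L N k (step42 L U) - levelAction d L N k (s (k + 1) U)| ≤ Dk k
  /-- (H2)+(D) a regular refinement of the coarser minimiser with controlled one-step action discrepancy exists -/
  refine : ∀ (k : ℕ) (U : Site d → Fin d → (Matrix n n ℂ)ˣ), IsMinimiserS d s 𝒞 L N k V U →
    ∃ Ut, Ut ∈ 𝒞 (k + 1) ∧ s (k + 1) Ut = U ∧ Regular d L N b g (k + 1) Ut ∧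
      |levelAction d L N k (step42 L Ut) - levelAction d L N k (s (k + 1) Ut)| ≤ Dk k

/-- **FOR (43) ITSELF THE NEW LETTER IS VOID**: pub-balaban's `SandwichData d 𝒞 L N b g V` gives `SandwichDataS d (step42 L) 𝒞 L N b g 0 V` (g0's `isMinimiserS_step42_iff`; the
discrepancy is `|x − x| = 0`). [folklore] -/
theorem sandwichDataS_step42_of {𝒞 : ℕ → Set (Site d → Fin d → (Matrix n n ℂ)ˣ)} {L N : ℕ} {b g : ℝ} {V : Site d → Fin d → (Matrix n n ℂ)ˣ}
    (h : SandwichData d 𝒞 L N b g V) : SandwichDataS d (fun _ => step42 L) 𝒞 L N b g (fun _ => 0) V where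
  exists_minimiser k := by
    obtain ⟨U, hU⟩ := h.exists_minimiser k
    exact ⟨U, (isMinimiserS_step42_iff L 𝒞 N k V U).2 hU⟩
  regular k U hU := h.regular k U ((isMinimiserS_step42_iff L 𝒞 N (k + 1) V U).1 hU)
  avg_mem k U hU := h.avg_mem k U ((isMinimiserS_step42_iff L 𝒞 N (k + 1) V U).1 hU)
  discr k U _ := by simp [step42]
  refine k U hU := by
    obtain ⟨Ut, hUt, havg, hreg⟩ := h.refine k U ((isMinimiserS_step42_iff L 𝒞 N k V U).1 hU)
    exact ⟨Ut, hUt, havg, hreg, by simp [step42]⟩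

/-! ## §2 The per-level rate bound -/

/-- **★★ THE PER-LEVEL RATE BOUND FOR THE SCHEME `s`**: under `SandwichDataS`, for `L, N ≥ 1`, `0 ≤ b`, `512(d+1)(d+4)L²b ≤ 1`:
`|inf A^{(k)}(admissibleS s 𝒞 k V) − inf A^{(k+1)}(admissibleS s 𝒞 (k+1) V)| ≤ [wallConstNA(d,L)(g + b³)∕L²]·(L^{−2})^k·N^d + Dk k` — pub-balaban's `abs_minAct_sub_le_rate` VERBATIM
(common radius `a = b∕L^{2(k+1)}`, common gradient bound, `rate_algebra`) on part 34's wall-sandwich with the extra letter. [folklore] -/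
theorem abs_sInf_sub_le_rate_add [Nonempty n] {s : ℕ → (Site d → Fin d → (Matrix n n ℂ)ˣ) → (Site d → Fin d → (Matrix n n ℂ)ˣ)}
    {𝒞 : ℕ → Set (Site d → Fin d → (Matrix n n ℂ)ˣ)} {L N : ℕ} (hL : 1 ≤ L) (hN : 1 ≤ N) {b g : ℝ} {Dk : ℕ → ℝ} (hb : 0 ≤ b)
    (hbs : 512 * (d + 1) * (d + 4) * (L : ℝ) ^ 2 * b ≤ 1) {V : Site d → Fin d → (Matrix n n ℂ)ˣ} (h : SandwichDataS d s 𝒞 L N b g Dk V) (k : ℕ) :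
    |sInf (levelAction d L N (k + 1) '' admissibleS s 𝒞 (k + 1) V) - sInf (levelAction d L N k '' admissibleS s 𝒞 k V)|
      ≤ wallConstNA d L * (g + b ^ 3) / (L : ℝ) ^ 2 * (((L : ℝ) ^ 2)⁻¹) ^ k * (N : ℝ) ^ d + Dk k := by
  obtain ⟨UA, hA⟩ := h.exists_minimiser k
  obtain ⟨UB, hB⟩ := h.exists_minimiser (k + 1)
  obtain ⟨Ut, hUt𝒞, havg, hTreg, hTD⟩ := h.refine k UA hA
  have hBreg := h.regular k UB hB
  have hW := h.avg_mem k UB hB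
  have hBD := h.discr k UB hB
  -- the common scale `σ = L^{k+1} ≥ 1`
  have hL0 : (0 : ℝ) < L := by exact_mod_cast (by omega : 0 < L)
  have hL1 : (1 : ℝ) ≤ L := by exact_mod_cast hL
  set σ : ℝ := (L : ℝ) ^ (k + 1) with hσdef
  have hσ1 : 1 ≤ σ := one_le_pow₀ hL1
  have hσ2 : 1 ≤ σ ^ 2 := one_le_pow₀ hσ1
  -- the common small-field radius `a = b/σ²`
  set a : ℝ := b / σ ^ 2 with hadef
  have ha : 0 ≤ a := div_nonneg hb (by positivity)
  have hab : a ≤ b := div_le_self hb hσ2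
  have hsmall : 512 * (d + 1) * (d + 4) * (L : ℝ) ^ 2 * a ≤ 1 := by
    have hc : 0 ≤ 512 * ((d : ℝ) + 1) * (d + 4) * (L : ℝ) ^ 2 := by positivity
    nlinarith
  -- the common gradient bound
  set G : ℝ := g * (N : ℝ) ^ d * σ ^ d / σ ^ 6 with hGdef
  have hmain := abs_sInf_succ_sub_sInf_le_wall_add hL hN hA hB hW hUt𝒞 havg hBreg.unitary hBreg.periodic hTreg.unitary hTreg.periodic ha hsmall
    hBreg.small hTreg.small hBreg.grad hTreg.grad hBD hTD
  -- `a³ (N L^k)^d ≤ b³ N^d σ^d / σ^6`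
  have hNr : (0 : ℝ) ≤ (N : ℝ) ^ d := by positivity
  have hM : ((N * L ^ k : ℕ) : ℝ) ^ d ≤ (N : ℝ) ^ d * σ ^ d := by
    push_cast
    rw [mul_pow]
    refine mul_le_mul_of_nonneg_left ?_ hNr
    exact pow_le_pow_left₀ (by positivity) (pow_le_pow_right₀ hL1 (Nat.le_succ k)) d
  have ha3 : a ^ 3 * ((N * L ^ k : ℕ) : ℝ) ^ d ≤ b ^ 3 * (N : ℝ) ^ d * σ ^ d / σ ^ 6 := by
    have h1 : a ^ 3 = b ^ 3 / σ ^ 6 := by rw [hadef, div_pow, ← pow_mul]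
    rw [h1, div_mul_eq_mul_div, mul_assoc]
    exact div_le_div_of_nonneg_right (mul_le_mul_of_nonneg_left hM (pow_nonneg hb 3)) (by positivity)
  have hsum : G + a ^ 3 * ((N * L ^ k : ℕ) : ℝ) ^ d ≤ (g + b ^ 3) * (N : ℝ) ^ d * σ ^ d / σ ^ 6 := by
    have : (g + b ^ 3) * (N : ℝ) ^ d * σ ^ d / σ ^ 6 = G + b ^ 3 * (N : ℝ) ^ d * σ ^ d / σ ^ 6 := by
      rw [hGdef]; ring
    rw [this]; linarith
  have hWc := wallConstNA_nonneg (d := d) L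
  have hc : 0 ≤ ((stepWt d L)⁻¹) ^ (k + 1) := pow_nonneg (inv_nonneg.mpr (stepWt_pos (d := d) L hL).le) _
  have hstep : ((stepWt d L)⁻¹) ^ (k + 1) * (wallConstNA d L * (G + a ^ 3 * ((N * L ^ k : ℕ) : ℝ) ^ d))
      ≤ ((stepWt d L)⁻¹) ^ (k + 1) * (wallConstNA d L * ((g + b ^ 3) * (N : ℝ) ^ d * σ ^ d / σ ^ 6)) :=
    mul_le_mul_of_nonneg_left (mul_le_mul_of_nonneg_left hsum hWc) hc
  have heq : ((stepWt d L)⁻¹) ^ (k + 1) * (wallConstNA d L * ((g + b ^ 3) * (N : ℝ) ^ d * σ ^ d / σ ^ 6))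
      = wallConstNA d L * (g + b ^ 3) / (L : ℝ) ^ 2 * (((L : ℝ) ^ 2)⁻¹) ^ k * (N : ℝ) ^ d := by
    rw [stepWt_inv_eq (d := d) L hL, hσdef]
    exact rate_algebra hL0.ne' k
  linarith

/-! ## §3 N16's END (A) for the `s`-constrained minimal actions -/

/-- **★★★ N16's ACTION-RATE END FOR AN ARBITRARY SCHEME `s` FROM SANDWICH DATA**: if every datum of `dom` carries `SandwichDataS d s 𝒞 L N b g Dk` and the one-step action
discrepancies of the competitors decay geometrically, `Dk k ≤ C_D·(L^{−2})^k·N^d`, then (for `L, N ≥ 1`, `0 ≤ b`, `512(d+1)(d+4)L²b ≤ 1`, `0 ≤ C_D`)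
`ActionRate ⟨dom, inf A^{(k)}(admissibleS s 𝒞 k ·), loc, N^d⟩ (wallConstNA(d,L)(g+b³)∕L² + C_D) (L^{−2})` — pub-balaban's `actionRate_of_sandwichData` for (43) with exactly ONE
new letter.  For `s := step04 F N` this is the (0.4)-side END (A) of N16 with its located inputs displayed. [folklore] -/
theorem actionRate_schemeReadings_of_sandwichDataS [Nonempty n] {s : ℕ → (Site d → Fin d → (Matrix n n ℂ)ˣ) → (Site d → Fin d → (Matrix n n ℂ)ˣ)}
    {𝒞 : ℕ → Set (Site d → Fin d → (Matrix n n ℂ)ˣ)} {L N : ℕ} (hL : 1 ≤ L) (hN : 1 ≤ N) {b g C_D : ℝ} {Dk : ℕ → ℝ} (hb : 0 ≤ b)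
    (hbs : 512 * (d + 1) * (d + 4) * (L : ℝ) ^ 2 * b ≤ 1) {dom : Set (Site d → Fin d → (Matrix n n ℂ)ˣ)}
    (hdom : ∀ V ∈ dom, SandwichDataS d s 𝒞 L N b g Dk V) (hDk : ∀ k, Dk k ≤ C_D * (((L : ℝ) ^ 2)⁻¹) ^ k * (N : ℝ) ^ d)
    {X : Type*} (loc : ℕ → (Site d → Fin d → (Matrix n n ℂ)ˣ) → X → ℝ) :
    ActionRate
      ({ dom := dom
         act := fun k V => sInf (levelAction d L N k '' admissibleS s 𝒞 k V)
         loc := loc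
         vol := (N : ℝ) ^ d
         vol_nonneg := by positivity } : T4EtaRateMin.Readings (Site d → Fin d → (Matrix n n ℂ)ˣ) X)
      (wallConstNA d L * (g + b ^ 3) / (L : ℝ) ^ 2 + C_D) (((L : ℝ) ^ 2)⁻¹) := by
  intro k V hV
  show |sInf (levelAction d L N (k + 1) '' admissibleS s 𝒞 (k + 1) V) - sInf (levelAction d L N k '' admissibleS s 𝒞 k V)|
    ≤ (wallConstNA d L * (g + b ^ 3) / (L : ℝ) ^ 2 + C_D) * (((L : ℝ) ^ 2)⁻¹) ^ k * (N : ℝ) ^ d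
  have h1 := abs_sInf_sub_le_rate_add hL hN hb hbs (hdom V hV) k
  have h2 := hDk k
  have e : (wallConstNA d L * (g + b ^ 3) / (L : ℝ) ^ 2 + C_D) * (((L : ℝ) ^ 2)⁻¹) ^ k * (N : ℝ) ^ d
      = wallConstNA d L * (g + b ^ 3) / (L : ℝ) ^ 2 * (((L : ℝ) ^ 2)⁻¹) ^ k * (N : ℝ) ^ d + C_D * (((L : ℝ) ^ 2)⁻¹) ^ k * (N : ℝ) ^ d := by ring
  rw [e]
  linarith

/-- **CONSISTENCY WITH pub-balaban**: for (43) (`s = step42`, `Dk = 0`, `C_D = 0`) the theorem is `MinimalActionRate.actionRate_of_sandwichData` up to g0's dictionary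
`admissibleS_step42` (same constant `wall(g+b³)∕L² + 0`). [folklore] -/
theorem actionRate_step42Readings_of_sandwichData [Nonempty n] {𝒞 : ℕ → Set (Site d → Fin d → (Matrix n n ℂ)ˣ)} {L N : ℕ} (hL : 1 ≤ L) (hN : 1 ≤ N) {b g : ℝ}
    (hb : 0 ≤ b) (hbs : 512 * (d + 1) * (d + 4) * (L : ℝ) ^ 2 * b ≤ 1) {dom : Set (Site d → Fin d → (Matrix n n ℂ)ˣ)}
    (hdom : ∀ V ∈ dom, SandwichData d 𝒞 L N b g V) {X : Type*} (loc : ℕ → (Site d → Fin d → (Matrix n n ℂ)ˣ) → X → ℝ) :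
    ActionRate
      ({ dom := dom
         act := fun k V => sInf (levelAction d L N k '' admissibleS (fun _ => step42 L) 𝒞 k V)
         loc := loc
         vol := (N : ℝ) ^ d
         vol_nonneg := by positivity } : T4EtaRateMin.Readings (Site d → Fin d → (Matrix n n ℂ)ˣ) X)
      (wallConstNA d L * (g + b ^ 3) / (L : ℝ) ^ 2 + 0) (((L : ℝ) ^ 2)⁻¹) :=
  actionRate_schemeReadings_of_sandwichDataS (Dk := fun _ => 0) hL hN hb hbs (fun V hV => sandwichDataS_step42_of (hdom V hV))
    (fun k => le_of_eq (by ring)) loc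

end

end Summit.QuantumFields.YangMills.BalabanUVNodes.N16SchemeSandwichRate
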